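import Summits.Ventures.QEC.Census.CertCoverBatch
import Summits.Ventures.QEC.Census.BB.A1s_n192_k4_0fa3ae82.CoreDefs
import HarnessLib

set_option Elab.async false
set_option maxRecDepth 200000

/-!
# `[[192,4,18]]` one-level cover certificate — LEVEL-1→0 coset problems 371…380 (problem 1 excluded: `Prob1.lean`) as COMPACT data
(`ProbData`: U, f, σ, y₀, allow; qec-type-10 `CertCoverBatch.mkCoset` rebuilds each `CosetProb` in the kernel) + their verdict
`probsOK cov covR hx hx1 D1 lxd 16` (one `decide +kernel`). qec-search-9 g5 (lead block 170 (0)(c)); data from JSON `level10.problems`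
(sha256 08367568…). Data + decided check; KERNEL.
-/

namespace Summit.Ventures.QEC.Census.A1s_n192_k4_0fa3ae82

open Matrix Summit.Ventures.QEC.Census Literature.InformationTheory.QuantumCodes

/-- Problems 371…380 (10): `⟨U, f, σ, y₀, allow⟩`. -/
def probs07c : List ProbData := [
    ⟨1818120364454154181042754, 0, 211106236858368, 9223512774343131136, [0]⟩,
    ⟨1818122679163347068453120, 1, 0, 0, [0, 549755813888, 4611686018427387904]⟩,
    ⟨1818123112634794022867200, 0, 0, 0, [0]⟩,
    ⟨1818124966991682892595456, 3, 0, 0, [0, 549755813888]⟩,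
    ⟨1818125003301959183271168, 1, 0, 0, [0, 549755813888, 36028797018963968]⟩,
    ⟨1818125183727423549802752, 0, 0, 0, [0]⟩,
    ⟨1818125328968494352505088, 0, 0, 0, [0]⟩,
    ⟨1818125400463129847009536, 2, 0, 0, [0, 17180000256, 549755944960, 566935683072]⟩,
    ⟨1818125436773406137685248, 0, 0, 0, [0]⟩,
    ⟨1818125690945340172415232, 0, 0, 0, [0]⟩]

set_option maxHeartbeats 400000000 in
/-- Every problem of this chunk passes (`mkCoset` elimination + `cosetOKD` + fast `σ` + depth + `BU`-evenness + label checks). -/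
theorem probs07c_ok : probsOK cov covR hx hx1 D1 lxd 16 probs07c = true := by
  decide +kernel

/-- Pointwise form. -/
theorem probs07c_all : ∀ x ∈ probs07c, probOK cov covR hx hx1 D1 lxd 16 x = true := by
  have h := probs07c_ok
  rwa [probsOK, List.all_eq_true] at h

end Summit.Ventures.QEC.Census.A1s_n192_k4_0fa3ae82
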